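import Summits.NavierStokesRegularity.NavierStokesRegularity.Theses.AxisymmetricExtremality
import Literature.Analysis.FluidPDE.AxisymOmegaEnergy
import HarnessLib

/-!
# Cut-off calculus for Seregin 2022, §2 Step 3: integration by parts against a compactly
# supported weight, `∫ ζ²G ΔG`, `∫ ζ²G DG[b]`, and the product rule for `(∂ᵣ·)/r` —
# crux stmt-NavierStokesRegularity-15453 (`AxisymmetricExtremality.AxisymmetricKatoGlobal`), line registered, support for stub `stub_sereginLogSwirlOrigin`

Support file (`--supports stmt-NavierStokesRegularity-15453`; theorems only, everything proved)
toward the registered stub `stub_sereginLogSwirlOrigin` = the named fact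
`Literature.Analysis.FluidPDE.seregin2022_logSwirl_regularAtOrigin` (G. Seregin, J. Math. Fluid
Mech. 24 (2022), Paper 27 = arXiv:2201.00153, §2). Step 3 there ("Local estimates of solutions",
arXiv p. 6) multiplies the equations of `Φ = ω_r/r` and `Γ = ω_θ/r`,
`∂ₜG + (v − 2x'/|x'|²)·∇G − ΔG + (source) = 0`, by `Gη⁶` and integrates by parts over `𝒞`; the
cut-off `η` is compactly supported, the solution is NOT assumed to decay, so every integration by
parts is against a compactly supported factor. This file supplies that calculus on `ℝ³`, for
`ζ = η³ ∈ C¹` (resp. `C²`) with compact support and `G ∈ C²` arbitrary (no integrability):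

* `integral_mul_fderiv_eq_neg_of_hasCompactSupport` — `∫ φ ∂ᵥψ = −∫ ∂ᵥφ ψ` (`φ ∈ C¹_c`, `ψ ∈ C¹`);
  `integral_fderiv_apply_eq_zero_of_hasCompactSupport` — `∫ ∂ᵥφ = 0`;
  `integral_fderiv_apply_eq_zero_of_isDivFree` — `∫ Dφ[u] = 0` for a divergence-free `u ∈ C¹`;
* `integral_sq_mul_mul_fderiv_fderiv`, `integral_sq_mul_mul_laplacian` —
  **`∫ ζ²G ΔG = ∫ G²|∇ζ|² − ∫ |∇(ζG)|²`** (the viscous term: `−ΔG · Gη⁶` gives the dissipation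
  `∫(η³|∇G|)²`-type term in the `η³G` form used by Step 4, `|η³G|²_{2,Q}`, plus the cut-off term);
* `integral_sq_mul_mul_fderiv_apply` (registered sub-goal) — **`∫ ζ²G DG[b] = −∫ ζG² Dζ[b]`** for
  a divergence-free drift `b` (the transport term `(v·∇G) Gη⁶` gives only a cut-off term);
* `radDerivQuot_mul` (registered sub-goal) — **`q_{ζG} = ζ q_G + G q_ζ`** for axisymmetric
  `ζ, G ∈ C²`, `q_F = radDerivQuot F = (∂ᵣF)/r` (the drift `−(2x'/|x'|²)·∇G = −2q_G`; with it the
  axis term of `ζ²G q_G` is that of `(ζG) q_{ζG}`, which has a sign,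
  `IsAxisymmetricScalar.integral_mul_radDerivQuot_nonpos`).

The energy identities themselves are in the sibling file `…Step3Gamma`.

## Mathlib / tree search

Mathlib: `integral_mul_fderiv_eq_neg_fderiv_mul_of_integrable` (by parts with integrable data),
`Continuous.integrable_of_hasCompactSupport`, `HasCompactSupport.fderiv_apply / mul_right / mono`,
`fderiv_fun_mul`. Tree: `fderiv_apply_eq_sum_three` (`AxisymOmegaEnergy`),
`divergence_eq_sum_three`, `fderiv_apply_coord_vec3`, `contDiff_apply_coord_vec3`
(`AxisymHouLiVariables`), `laplacian_eq_sum_fderiv_fderiv` (`WholeSpaceIBP`),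
`contDiff_fderiv_apply_const_succ`, `eq_of_eq_off_ker` (`AxisymmetricLiftR5`),
`mul_radDerivQuot_eq_fderiv_zero`, `continuous_radDerivQuot` (`AxisymRadialQuotient`),
`IsAxisymmetricScalar.mul` (`HouLeiLiEstimate`). The tree's transport/Laplacian lemmas
(`integral_mul_fderiv_apply_eq_zero_of_isDivFree`, `integral_mul_laplacian_eq_neg`,
`AxisymTransportIBP`) assume globally bounded drifts and `L²` data; here compact support of the
weight replaces both. `lean search 'integral_sq_mul_mul|radDerivQuot_mul|of_hasCompactSupport.*fderiv_apply_eq'`: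
no matches (2026-08-17).

## References

* G. Seregin, J. Math. Fluid Mech. 24 (2022), Paper No. 27 = arXiv:2201.00153, §2 Step 3
  (arXiv p. 6: "Let us multiply the first equation by `Φη⁶` and the second equation by `Γη⁶`.
  After integration by parts, we find …"). [`Seregin2022LocalAxisym`]
-/

noncomputable section

open MeasureTheory Set Filter Topology Function
open scoped ENNReal ContDiff Laplacian
open Literature.Analysis.FluidPDE

-- `<Problem> = <Summit>` duplicates a namespace component by design (lakefile sets the same option).
set_option linter.dupNamespace false

namespace Summit.NavierStokesRegularity.NavierStokesRegularity.Theorems.AxisymmetricKatoGlobal.EulerScaling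

/-! ### Integration by parts against a compactly supported factor -/

section Calculus

variable {φ ψ : EuclideanSpace ℝ (Fin 3) → ℝ} {u : EuclideanSpace ℝ (Fin 3) → EuclideanSpace ℝ (Fin 3)}

/-- Product rule, applied form: `D(φψ)(x) v = φ(x) Dψ(x) v + ψ(x) Dφ(x) v`. [folklore] -/
theorem fderiv_mul_apply_of_differentiableAt {x : EuclideanSpace ℝ (Fin 3)}
    (hφ : DifferentiableAt ℝ φ x) (hψ : DifferentiableAt ℝ ψ x) (v : EuclideanSpace ℝ (Fin 3)) :
    fderiv ℝ (fun y => φ y * ψ y) x v = φ x * fderiv ℝ ψ x v + ψ x * fderiv ℝ φ x v := by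
  rw [fderiv_fun_mul hφ hψ]
  simp only [_root_.add_apply, _root_.FunLike.coe_smul, Pi.smul_apply, smul_eq_mul]

/-- A function vanishing wherever the compactly supported `f` vanishes is compactly supported.
[folklore] -/
theorem hasCompactSupport_of_eq_zero {f g : EuclideanSpace ℝ (Fin 3) → ℝ} (hf : HasCompactSupport f)
    (h : ∀ x, f x = 0 → g x = 0) : HasCompactSupport g :=
  hf.mono fun x hx hfx => hx (h x hfx)

/-- `x ↦ Dφ(x) v` is continuous for `φ ∈ C¹`. [folklore] -/
theorem continuous_fderiv_apply_of_contDiff (hφ : ContDiff ℝ 1 φ) (v : EuclideanSpace ℝ (Fin 3)) :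
    Continuous fun x => fderiv ℝ φ x v :=
  (hφ.continuous_fderiv one_ne_zero).clm_apply continuous_const

/-- **Integration by parts with a compactly supported factor**: `∫ φ ∂ᵥψ = −∫ ∂ᵥφ ψ` for
`φ ∈ C¹` with compact support and `ψ ∈ C¹` (no decay of `ψ` needed). [folklore] -/
theorem integral_mul_fderiv_eq_neg_of_hasCompactSupport (hφ : ContDiff ℝ 1 φ)
    (hφc : HasCompactSupport φ) (hψ : ContDiff ℝ 1 ψ) (v : EuclideanSpace ℝ (Fin 3)) :
    ∫ x, φ x * fderiv ℝ ψ x v = -∫ x, fderiv ℝ φ x v * ψ x := by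
  have hφd : Differentiable ℝ φ := hφ.differentiable one_ne_zero
  have hψd : Differentiable ℝ ψ := hψ.differentiable one_ne_zero
  refine integral_mul_fderiv_eq_neg_fderiv_mul_of_integrable ?_ ?_ ?_ (fun x _ => hφd x)
    (fun x _ => hψd x)
  · exact ((continuous_fderiv_apply_of_contDiff hφ v).mul hψ.continuous).integrable_of_hasCompactSupport
      (hφc.fderiv_apply ℝ v).mul_right
  · exact (hφ.continuous.mul (continuous_fderiv_apply_of_contDiff hψ v)).integrable_of_hasCompactSupport
      hφc.mul_right
  · exact (hφ.continuous.mul hψ.continuous).integrable_of_hasCompactSupport hφc.mul_right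

/-- `∫ ∂ᵥφ = 0` for `φ ∈ C¹` with compact support. [folklore] -/
theorem integral_fderiv_apply_eq_zero_of_hasCompactSupport (hφ : ContDiff ℝ 1 φ)
    (hφc : HasCompactSupport φ) (v : EuclideanSpace ℝ (Fin 3)) :
    ∫ x, fderiv ℝ φ x v = 0 := by
  have h := integral_mul_fderiv_eq_neg_of_hasCompactSupport hφ hφc
    (contDiff_const (c := (1 : ℝ))) v
  simp only [fderiv_fun_const, Pi.zero_apply, _root_.zero_apply, mul_zero,
    integral_zero, mul_one] at h
  linarith

/-- **The divergence theorem without boundary**: `∫ Dφ[u] = 0` for `φ ∈ C¹` with compact support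
and a divergence-free `u ∈ C¹` (`Dφ[u] = div (φ u) − φ div u`). [folklore] -/
theorem integral_fderiv_apply_eq_zero_of_isDivFree (hφ : ContDiff ℝ 1 φ) (hφc : HasCompactSupport φ)
    (hu : ContDiff ℝ 1 u) (hdiv : VectorCalculus.IsDivFree u) :
    ∫ x, fderiv ℝ φ x (u x) = 0 := by
  have hφd : Differentiable ℝ φ := hφ.differentiable one_ne_zero
  have hud : Differentiable ℝ u := hu.differentiable one_ne_zero
  have hui : ∀ i : Fin 3, ContDiff ℝ 1 fun x => u x i := fun i => contDiff_apply_coord_vec3 hu i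
  have huid : ∀ i : Fin 3, Differentiable ℝ fun x => u x i := fun i =>
    (hui i).differentiable one_ne_zero
  -- `∫ uᵢ ∂ᵢφ = -∫ ∂ᵢuᵢ φ`
  have hI : ∀ i : Fin 3, ∫ x, u x i * fderiv ℝ φ x (EuclideanSpace.single i 1) =
      -∫ x, fderiv ℝ u x (EuclideanSpace.single i 1) i * φ x := by
    intro i
    have h := integral_mul_fderiv_eq_neg_of_hasCompactSupport hφ hφc (hui i)
      (EuclideanSpace.single i 1)
    -- `h : ∫ φ ∂ᵢuᵢ = -∫ ∂ᵢφ uᵢ`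
    have e1 : ∫ x, u x i * fderiv ℝ φ x (EuclideanSpace.single i 1) =
        ∫ x, fderiv ℝ φ x (EuclideanSpace.single i 1) * u x i :=
      integral_congr_ae (Eventually.of_forall fun x => mul_comm _ _)
    have e2 : ∫ x, fderiv ℝ u x (EuclideanSpace.single i 1) i * φ x =
        ∫ x, φ x * fderiv ℝ (fun y => u y i) x (EuclideanSpace.single i 1) :=
      integral_congr_ae (Eventually.of_forall fun x => by
        simp only [fderiv_apply_coord_vec3 (hud x) i]; ring)
    rw [e1, e2, h]
    ring
  -- integrability of the three pieces
  have hint : ∀ i : Fin 3, Integrable (fun x => u x i * fderiv ℝ φ x (EuclideanSpace.single i 1)) :=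
    fun i => ((hui i).continuous.mul (continuous_fderiv_apply_of_contDiff hφ _)).integrable_of_hasCompactSupport
      (hφc.fderiv_apply ℝ _).mul_left
  have hint' : ∀ i : Fin 3, Integrable
      (fun x => fderiv ℝ u x (EuclideanSpace.single i 1) i * φ x) := fun i => by
    have hc : Continuous fun x => fderiv ℝ u x (EuclideanSpace.single i 1) i := by
      have := continuous_fderiv_apply_of_contDiff (hui i) (EuclideanSpace.single i 1)
      refine this.congr fun x => ?_
      exact fderiv_apply_coord_vec3 (hud x) i _
    exact (hc.mul hφ.continuous).integrable_of_hasCompactSupport hφc.mul_left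
  have hint01 : Integrable (fun x => u x 0 * fderiv ℝ φ x (EuclideanSpace.single 0 1) +
      u x 1 * fderiv ℝ φ x (EuclideanSpace.single 1 1)) := (hint 0).add (hint 1)
  have hsplit : ∫ x, fderiv ℝ φ x (u x) =
      (∫ x, u x 0 * fderiv ℝ φ x (EuclideanSpace.single 0 1)) +
      (∫ x, u x 1 * fderiv ℝ φ x (EuclideanSpace.single 1 1)) +
      (∫ x, u x 2 * fderiv ℝ φ x (EuclideanSpace.single 2 1)) := by
    rw [← integral_add (hint 0) (hint 1), ← integral_add hint01 (hint 2)]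
    refine integral_congr_ae (Eventually.of_forall fun x => ?_)
    beta_reduce
    rw [fderiv_apply_eq_sum_three φ x (u x)]
  have hint01' : Integrable (fun x => fderiv ℝ u x (EuclideanSpace.single 0 1) 0 * φ x +
      fderiv ℝ u x (EuclideanSpace.single 1 1) 1 * φ x) := (hint' 0).add (hint' 1)
  have hdivint : (∫ x, fderiv ℝ u x (EuclideanSpace.single 0 1) 0 * φ x) +
      (∫ x, fderiv ℝ u x (EuclideanSpace.single 1 1) 1 * φ x) +
      (∫ x, fderiv ℝ u x (EuclideanSpace.single 2 1) 2 * φ x) = 0 := by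
    rw [← integral_add (hint' 0) (hint' 1), ← integral_add hint01' (hint' 2)]
    refine integral_eq_zero_of_ae (Eventually.of_forall fun x => ?_)
    beta_reduce
    simp only [Pi.zero_apply]
    have h := divergence_eq_sum_three u x
    rw [hdiv x] at h
    calc fderiv ℝ u x (EuclideanSpace.single 0 1) 0 * φ x +
          fderiv ℝ u x (EuclideanSpace.single 1 1) 1 * φ x +
          fderiv ℝ u x (EuclideanSpace.single 2 1) 2 * φ x
        = (fderiv ℝ u x (EuclideanSpace.single 0 1) 0 + fderiv ℝ u x (EuclideanSpace.single 1 1) 1 +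
            fderiv ℝ u x (EuclideanSpace.single 2 1) 2) * φ x := by ring
      _ = 0 := by rw [← h, zero_mul]
  rw [hsplit, hI 0, hI 1, hI 2]
  linarith

end Calculus

/-! ### The cut-off calculus: `∫ ζ²G ΔG` and `∫ ζ²G DG[b]` -/

section Cutoff

variable {ζ G : EuclideanSpace ℝ (Fin 3) → ℝ} {b : EuclideanSpace ℝ (Fin 3) → EuclideanSpace ℝ (Fin 3)}

/-- `D(ζ²G) v = ζ² DG v + 2ζG Dζ v`. [folklore] -/
theorem fderiv_sq_mul_apply {x : EuclideanSpace ℝ (Fin 3)} (hζ : DifferentiableAt ℝ ζ x)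
    (hG : DifferentiableAt ℝ G x) (v : EuclideanSpace ℝ (Fin 3)) :
    fderiv ℝ (fun y => ζ y ^ 2 * G y) x v =
      ζ x ^ 2 * fderiv ℝ G x v + 2 * ζ x * G x * fderiv ℝ ζ x v := by
  have h : (fun y => ζ y ^ 2 * G y) = fun y => ζ y * (ζ y * G y) := by
    funext y; ring
  rw [h, fderiv_mul_apply_of_differentiableAt hζ (hζ.fun_mul hG),
    fderiv_mul_apply_of_differentiableAt hζ hG]
  ring

/-- A continuous function times the compactly supported continuous weight `ζ² G` is integrable.
[folklore] -/
theorem integrable_sq_mul_mul (hζ : Continuous ζ) (hζc : HasCompactSupport ζ) (hG : Continuous G)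
    {f : EuclideanSpace ℝ (Fin 3) → ℝ} (hf : Continuous f) :
    Integrable (fun x => ζ x ^ 2 * G x * f x) := by
  refine (((hζ.pow 2).mul hG).mul hf).integrable_of_hasCompactSupport ?_
  exact hasCompactSupport_of_eq_zero hζc fun x hx => by simp [hx]

/-- **One direction of `∫ ζ²G ΔG`**: `∫ ζ²G ∂ₑ∂ₑG = ∫ G²(∂ₑζ)² − ∫ (∂ₑ(ζG))²` for `ζ ∈ C¹`
compactly supported and `G ∈ C²` (by parts once, then complete the square). [folklore] -/
theorem integral_sq_mul_mul_fderiv_fderiv (hζ : ContDiff ℝ 1 ζ) (hζc : HasCompactSupport ζ)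
    (hG : ContDiff ℝ 2 G) (e : EuclideanSpace ℝ (Fin 3)) :
    ∫ x, ζ x ^ 2 * G x * fderiv ℝ (fun y => fderiv ℝ G y e) x e =
      (∫ x, G x ^ 2 * fderiv ℝ ζ x e ^ 2) - ∫ x, fderiv ℝ (fun y => ζ y * G y) x e ^ 2 := by
  have hG1 : ContDiff ℝ 1 G := hG.of_le (by norm_num)
  have hζd : Differentiable ℝ ζ := hζ.differentiable one_ne_zero
  have hGd : Differentiable ℝ G := hG1.differentiable one_ne_zero
  have hGe : ContDiff ℝ 1 fun y => fderiv ℝ G y e :=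
    contDiff_fderiv_apply_const_succ (n := 1) (by exact_mod_cast hG) e
  have hφ : ContDiff ℝ 1 fun y => ζ y ^ 2 * G y := (hζ.pow 2).mul hG1
  have hφc : HasCompactSupport fun y => ζ y ^ 2 * G y :=
    hasCompactSupport_of_eq_zero hζc fun x hx => by simp [hx]
  have h := integral_mul_fderiv_eq_neg_of_hasCompactSupport hφ hφc hGe e
  rw [h]
  -- the two sides agree pointwise after the product rule
  have hi1 : Integrable (fun x => G x ^ 2 * fderiv ℝ ζ x e ^ 2) :=
    ((hG.continuous.pow 2).mul ((continuous_fderiv_apply_of_contDiff hζ e).pow 2)).integrable_of_hasCompactSupport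
      (hasCompactSupport_of_eq_zero (hζc.fderiv_apply ℝ e) fun x hx => by simp [hx])
  have hζGc : HasCompactSupport fun y => ζ y * G y := hζc.mul_right
  have hi2 : Integrable (fun x => fderiv ℝ (fun y => ζ y * G y) x e ^ 2) :=
    ((continuous_fderiv_apply_of_contDiff (hζ.mul hG1) e).pow 2).integrable_of_hasCompactSupport
      (hasCompactSupport_of_eq_zero (hζGc.fderiv_apply ℝ e) fun x hx => by simp [hx])
  rw [← integral_sub hi1 hi2, ← integral_neg]
  refine integral_congr_ae (Eventually.of_forall fun x => ?_)
  beta_reduce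
  rw [fderiv_sq_mul_apply (hζd x) (hGd x), fderiv_mul_apply_of_differentiableAt (hζd x) (hGd x)]
  ring

/-- **`∫ ζ²G ΔG = ∫ G²|∇ζ|² − ∫ |∇(ζG)|²`** for `ζ ∈ C¹` compactly supported and `G ∈ C²`.
[folklore] -/
theorem integral_sq_mul_mul_laplacian (hζ : ContDiff ℝ 1 ζ) (hζc : HasCompactSupport ζ)
    (hG : ContDiff ℝ 2 G) :
    ∫ x, ζ x ^ 2 * G x * (Δ G) x =
      (∫ x, G x ^ 2 * (fderiv ℝ ζ x (EuclideanSpace.single 0 1) ^ 2 +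
        fderiv ℝ ζ x (EuclideanSpace.single 1 1) ^ 2 + fderiv ℝ ζ x (EuclideanSpace.single 2 1) ^ 2)) -
      ∫ x, (fderiv ℝ (fun y => ζ y * G y) x (EuclideanSpace.single 0 1) ^ 2 +
        fderiv ℝ (fun y => ζ y * G y) x (EuclideanSpace.single 1 1) ^ 2 +
        fderiv ℝ (fun y => ζ y * G y) x (EuclideanSpace.single 2 1) ^ 2) := by
  have hG1 : ContDiff ℝ 1 G := hG.of_le (by norm_num)
  have hI := fun i : Fin 3 =>
    integral_sq_mul_mul_fderiv_fderiv hζ hζc hG (EuclideanSpace.single i 1)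
  -- integrability of the pieces
  have iJ : ∀ i : Fin 3, Integrable (fun x => ζ x ^ 2 * G x *
      fderiv ℝ (fun y => fderiv ℝ G y (EuclideanSpace.single i 1)) x (EuclideanSpace.single i 1)) :=
    fun i => integrable_sq_mul_mul hζ.continuous hζc hG.continuous
      (continuous_fderiv_apply_of_contDiff
        (contDiff_fderiv_apply_const_succ (n := 1) (by exact_mod_cast hG) _) _)
  have iA : ∀ i : Fin 3, Integrable (fun x => G x ^ 2 * fderiv ℝ ζ x (EuclideanSpace.single i 1) ^ 2) :=
    fun i => ((hG.continuous.pow 2).mul ((continuous_fderiv_apply_of_contDiff hζ _).pow 2)).integrable_of_hasCompactSupport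
      (hasCompactSupport_of_eq_zero (hζc.fderiv_apply ℝ (EuclideanSpace.single i 1))
        fun x hx => by simp [hx])
  have hζGc : HasCompactSupport fun y => ζ y * G y := hζc.mul_right
  have iB : ∀ i : Fin 3, Integrable
      (fun x => fderiv ℝ (fun y => ζ y * G y) x (EuclideanSpace.single i 1) ^ 2) := fun i =>
    ((continuous_fderiv_apply_of_contDiff (hζ.mul hG1) _).pow 2).integrable_of_hasCompactSupport
      (hasCompactSupport_of_eq_zero (hζGc.fderiv_apply ℝ (EuclideanSpace.single i 1))
        fun x hx => by simp [hx])
  have hlap : ∀ x, ζ x ^ 2 * G x * (Δ G) x =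
      ζ x ^ 2 * G x * fderiv ℝ (fun y => fderiv ℝ G y (EuclideanSpace.single 0 1)) x (EuclideanSpace.single 0 1) +
      ζ x ^ 2 * G x * fderiv ℝ (fun y => fderiv ℝ G y (EuclideanSpace.single 1 1)) x (EuclideanSpace.single 1 1) +
      ζ x ^ 2 * G x * fderiv ℝ (fun y => fderiv ℝ G y (EuclideanSpace.single 2 1)) x (EuclideanSpace.single 2 1) := by
    intro x
    rw [laplacian_eq_sum_fderiv_fderiv (EuclideanSpace.basisFun (Fin 3) ℝ) hG x]
    simp only [EuclideanSpace.basisFun_apply, Fin.sum_univ_three]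
    ring
  have iJ01 : Integrable (fun x =>
      ζ x ^ 2 * G x * fderiv ℝ (fun y => fderiv ℝ G y (EuclideanSpace.single 0 1)) x (EuclideanSpace.single 0 1) +
      ζ x ^ 2 * G x * fderiv ℝ (fun y => fderiv ℝ G y (EuclideanSpace.single 1 1)) x (EuclideanSpace.single 1 1)) :=
    (iJ 0).add (iJ 1)
  have iA01 : Integrable (fun x => G x ^ 2 * fderiv ℝ ζ x (EuclideanSpace.single 0 1) ^ 2 +
      G x ^ 2 * fderiv ℝ ζ x (EuclideanSpace.single 1 1) ^ 2) := (iA 0).add (iA 1)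
  have iB01 : Integrable (fun x => fderiv ℝ (fun y => ζ y * G y) x (EuclideanSpace.single 0 1) ^ 2 +
      fderiv ℝ (fun y => ζ y * G y) x (EuclideanSpace.single 1 1) ^ 2) := (iB 0).add (iB 1)
  have eA : ∫ x, G x ^ 2 * (fderiv ℝ ζ x (EuclideanSpace.single 0 1) ^ 2 +
      fderiv ℝ ζ x (EuclideanSpace.single 1 1) ^ 2 + fderiv ℝ ζ x (EuclideanSpace.single 2 1) ^ 2) =
      (∫ x, G x ^ 2 * fderiv ℝ ζ x (EuclideanSpace.single 0 1) ^ 2) +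
      (∫ x, G x ^ 2 * fderiv ℝ ζ x (EuclideanSpace.single 1 1) ^ 2) +
      (∫ x, G x ^ 2 * fderiv ℝ ζ x (EuclideanSpace.single 2 1) ^ 2) := by
    rw [← integral_add (iA 0) (iA 1), ← integral_add iA01 (iA 2)]
    refine integral_congr_ae (Eventually.of_forall fun x => ?_)
    beta_reduce
    ring
  have eB : ∫ x, (fderiv ℝ (fun y => ζ y * G y) x (EuclideanSpace.single 0 1) ^ 2 +
      fderiv ℝ (fun y => ζ y * G y) x (EuclideanSpace.single 1 1) ^ 2 +
      fderiv ℝ (fun y => ζ y * G y) x (EuclideanSpace.single 2 1) ^ 2) =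
      (∫ x, fderiv ℝ (fun y => ζ y * G y) x (EuclideanSpace.single 0 1) ^ 2) +
      (∫ x, fderiv ℝ (fun y => ζ y * G y) x (EuclideanSpace.single 1 1) ^ 2) +
      (∫ x, fderiv ℝ (fun y => ζ y * G y) x (EuclideanSpace.single 2 1) ^ 2) := by
    rw [← integral_add (iB 0) (iB 1), ← integral_add iB01 (iB 2)]
  rw [integral_congr_ae (Eventually.of_forall hlap), integral_add iJ01 (iJ 2),
    integral_add (iJ 0) (iJ 1), hI 0, hI 1, hI 2, eA, eB]
  ring

/-- **The localised transport term**: `∫ ζ²G DG[b] = −∫ ζG² Dζ[b]` for `ζ ∈ C¹` compactly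
supported, `G ∈ C¹` and a divergence-free `b ∈ C¹` (`∫ D((ζG)²)[b] = 0`). [folklore] -/
theorem integral_sq_mul_mul_fderiv_apply : ∀ (ζ G : EuclideanSpace ℝ (Fin 3) → ℝ) (b : EuclideanSpace ℝ (Fin 3) → EuclideanSpace ℝ (Fin 3)), ContDiff ℝ 1 ζ → HasCompactSupport ζ → ContDiff ℝ 1 G → ContDiff ℝ 1 b → VectorCalculus.IsDivFree b → ∫ x, ζ x ^ 2 * G x * fderiv ℝ G x (b x) = -∫ x, ζ x * G x ^ 2 * fderiv ℝ ζ x (b x) := by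
  intro ζ G b hζ hζc hG hb hdiv
  have hζd : Differentiable ℝ ζ := hζ.differentiable one_ne_zero
  have hGd : Differentiable ℝ G := hG.differentiable one_ne_zero
  have hF : ContDiff ℝ 1 fun y => (ζ y * G y) * (ζ y * G y) := (hζ.mul hG).mul (hζ.mul hG)
  have hFc : HasCompactSupport fun y => (ζ y * G y) * (ζ y * G y) :=
    (hζc.mul_right).mul_right
  have h0 := integral_fderiv_apply_eq_zero_of_isDivFree hF hFc hb hdiv
  have hpt : ∀ x, fderiv ℝ (fun y => (ζ y * G y) * (ζ y * G y)) x (b x) =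
      2 * (ζ x ^ 2 * G x * fderiv ℝ G x (b x)) + 2 * (ζ x * G x ^ 2 * fderiv ℝ ζ x (b x)) := by
    intro x
    rw [fderiv_mul_apply_of_differentiableAt ((hζd x).fun_mul (hGd x)) ((hζd x).fun_mul (hGd x)),
      fderiv_mul_apply_of_differentiableAt (hζd x) (hGd x)]
    ring
  have hDb : Continuous fun x => fderiv ℝ G x (b x) :=
    (hG.continuous_fderiv one_ne_zero).clm_apply hb.continuous
  have hDζb : Continuous fun x => fderiv ℝ ζ x (b x) :=
    (hζ.continuous_fderiv one_ne_zero).clm_apply hb.continuous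
  have i1 : Integrable (fun x => ζ x ^ 2 * G x * fderiv ℝ G x (b x)) :=
    integrable_sq_mul_mul hζ.continuous hζc hG.continuous hDb
  have i2 : Integrable (fun x => ζ x * G x ^ 2 * fderiv ℝ ζ x (b x)) :=
    ((hζ.continuous.mul (hG.continuous.pow 2)).mul hDζb).integrable_of_hasCompactSupport
      (hζc.mul_right).mul_right
  rw [integral_congr_ae (Eventually.of_forall hpt), integral_add (i1.const_mul 2) (i2.const_mul 2),
    integral_const_mul, integral_const_mul] at h0
  linarith

end Cutoff

/-! ### The product rule for `(∂ᵣ·)/r` -/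

section RadDeriv

variable {ζ G : EuclideanSpace ℝ (Fin 3) → ℝ}

/-- **Product rule for the radial derivative quotient**: `q_{ζG} = ζ q_G + G q_ζ` everywhere, for
axisymmetric scalars `ζ, G ∈ C²` (`q_F = radDerivQuot F = (∂ᵣF)/r`; off `{x₀ = 0}` both sides are
`∂₀(ζG)/x₀`, and both are continuous). [folklore] -/
theorem radDerivQuot_mul : ∀ (ζ G : EuclideanSpace ℝ (Fin 3) → ℝ), ContDiff ℝ 2 ζ → ContDiff ℝ 2 G → IsAxisymmetricScalar ζ → IsAxisymmetricScalar G → ∀ x : EuclideanSpace ℝ (Fin 3), radDerivQuot (fun y => ζ y * G y) x = ζ x * radDerivQuot G x + G x * radDerivQuot ζ x := by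
  intro ζ G hζ hG hζax hGax x
  have hP : ContDiff ℝ 2 fun y => ζ y * G y := hζ.mul hG
  have hPax : IsAxisymmetricScalar fun y => ζ y * G y := hζax.mul hGax
  have hζd : Differentiable ℝ ζ := hζ.differentiable two_ne_zero
  have hGd : Differentiable ℝ G := hG.differentiable two_ne_zero
  have hc1 : Continuous (radDerivQuot fun y => ζ y * G y) := continuous_radDerivQuot hP
  have hc2 : Continuous fun y => ζ y * radDerivQuot G y + G y * radDerivQuot ζ y :=
    (hζ.continuous.mul (continuous_radDerivQuot hG)).add (hG.continuous.mul (continuous_radDerivQuot hζ))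
  refine eq_of_eq_off_ker (EuclideanSpace.proj (0 : Fin 3)) ⟨EuclideanSpace.single 0 1, by simp⟩
    hc1 hc2 (fun z hz => ?_) x
  have hz0 : z 0 ≠ 0 := by simpa using hz
  have h1 := mul_radDerivQuot_eq_fderiv_zero hP hPax z
  have h2 := mul_radDerivQuot_eq_fderiv_zero hG hGax z
  have h3 := mul_radDerivQuot_eq_fderiv_zero hζ hζax z
  rw [fderiv_mul_apply_of_differentiableAt (hζd z) (hGd z), ← h2, ← h3] at h1
  apply mul_left_cancel₀ hz0
  rw [h1]
  ring

end RadDeriv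

end Summit.NavierStokesRegularity.NavierStokesRegularity.Theorems.AxisymmetricKatoGlobal.EulerScaling

end
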